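import Summits.BirchSwinnertonDyer.BirchSwinnertonDyer.Theorems.SylvesterTwoHeegnerIndexCoupledDescentFirstLayerOfL1
import Summits.BirchSwinnertonDyer.BirchSwinnertonDyer.Theorems.SylvesterTwoHeegnerIndexCoupledDescentCebotarevBottomClass
import Literature.NumberTheory.DiophantineGeometry.Conductor
import HarnessLib

/-!
# FIRST LAYER at the HSY pair from leaf (L1) and a NON-2-DIVISIBLE bottom point (no display) —
# and what VARIANT L's leaf stubs `stub_L1Four` / `stub_L1Seven` prove at EVERY member

Crux `UpperOffV0HSYPlus` (stmt-BirchSwinnertonDyer-19804); skeleton of record VARIANT L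
(`Cruxes/UpperOffV0HSYPlus/Lines/coupled_variantL.lean` c745230b5cc31032, planner D439) with leaf stubs
`stub_L1Four` / `stub_L1Seven` = leaf (L1) of THEOREM K2's deduction (p620148) for EVERY
non-`2`-divisible bottom point `Y₀ ∈ E_p(K)`, at EVERY member `p` (no `Ш_an` / `m(p)` antecedent).

§1 `natCard_primaryComponent_sha_eq_one_pair_of_nondiv_of_L1`: the first-layer assembly of p646146
(`…_of_display_of_L1`) with the height display replaced by its ONE use, «`Y₀` is not `2`-divisible»:
(L1)[δY₀] + `Y₀ ∉ 2E_p(K)` + `rank_ℤ B(K) = 2` + `conductorNorm ∣ N` ⇒ `#Ш(B/ℚ)[2^∞] = #Ш(A/ℚ)[2^∞] = 1`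
((L2A/B) p643067, (L3a) p635187, (L3b) p640670, K2 p620148, Ш-currency p621108 inside).  This is the
shape the rows use for their CM bottom point `P₁^{χ_B}` directly.
§2 `exists_not_two_nsmul_eq_cubeSumCurve`: `rank_ℤ E_p(K) = 2 ⇒` some point of `E_p(K)` is not
`2`-divisible (`#δ(E_p(K)) = 4`, p639767).
§3 `natCard_sha_eq_one_pair_of_L1Four` / `…_of_L1Seven`: VARIANT L's leaf stub (its statement
VERBATIM as a hypothesis) together with `PublishedFactsTwoPlus` (only its `rank_ℤ E_p(ℚ(ζ₃)) = 2`
conjunct is used) proves `#Ш(B)[2^∞] = #Ш(A)[2^∞] = 1` for EVERY member `p ≡ 4 (9)` (resp. `7 (9)`)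
and every pair of minimal models — with NO `ord₂(#Ш_an(B)·#Ш_an(A)) = 0` hypothesis.  That is THEOREM
K2's conclusion OFF its `m(p) = 0` slice, which is false at the certified members with
`Ш(E_p)[2] ≅ (ℤ/2)⁴` (1054327, 1062931, 1303213; 562399, 1113379, 1204729 — `…LowerHalfTwoRankFourMembers`)
— see the sibling file `…CoupledDescentL1FamilyVacuity` for the Negative lemmas and the vacuity of
VARIANT L's tail stubs.  ROOT CAUSE: on paper (L1)[δY₀] for an arbitrary non-divisible `Y₀` is only
available when the CM bottom point `P₁^{χ_B}` itself is not `2`-divisible (`m(p) = 0`); the leaf stub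
must carry the first layer's own antecedent (`padicValRat 2 (qB·qA) = 0`).  Theorem-only; nothing is
asserted on 19804; no stub closed; no label moves; BSD not claimed for any curve.
-/

set_option linter.dupNamespace false -- Summits modules are `Summit.<Summit>.<Problem>…` by design

noncomputable section

open scoped Classical
open WeierstrassCurve WeierstrassCurve.Affine WeierstrassCurve.Affine.Point NumberField IsDedekindDomain
open Field Literature.NumberTheory.EllipticCurves Literature.NumberTheory.GaloisRepresentations
open Literature.NumberTheory.EllipticCurves.HuShuYin2019
open Summit.BirchSwinnertonDyer.BirchSwinnertonDyer.Theses.SylvesterTwoHeegnerIndex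
  hiding HSYPointTwoDivisibleSevenModNine

namespace Summit.BirchSwinnertonDyer.BirchSwinnertonDyer.Theorems.SylvesterTwoCoupledDescentCebotarev

open SylvesterTwoCoupledDescentAtTwo SylvesterTwoCoupledDescentShaCurrency SylvesterTwoCoupledDuality

section Pair

variable {K : Type} [Field K] [NumberField K]

/-- **FIRST LAYER at the HSY pair from leaf (L1) and a non-`2`-divisible bottom point.**  Frame:
`K ∋ ω` quadratic (`ω² + ω + 1 = 0`), `p ≡ 1 (3)` prime, `ℚ`-models `A, B` of `E_{3p²}, E_p`
(`CA • A = cubeSumCurve (3p²)`, `CB • B = cubeSumCurve p`), `rank_ℤ B(K) = 2`, levels `N_A, N_B ≠ 0`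
divisible by the conductors of the short models, `Y₀ ∈ E_p(K)` NOT `2`-divisible, and (L1) for the
bottom class `δY₀` (coupled classes Selmer off their level with the two FLIP criteria at `λ ∋ ℓ`, for
the Kolyvagin primes of the (L3) files).  Then `#Ш(B/ℚ)[2^∞] = 1` and `#Ш(A/ℚ)[2^∞] = 1`.
(= p646146's `…_of_display_of_L1` with the display replaced by its one use.) -/
theorem natCard_primaryComponent_sha_eq_one_pair_of_nondiv_of_L1
    (h2 : Module.finrank ℚ K = 2) {ω : K} (hω : ω ^ 2 + ω + 1 = 0) {p : ℕ} (hp : p.Prime)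
    (hp3 : p % 3 = 1) (A B : WeierstrassCurve ℚ) [A.IsElliptic] [B.IsElliptic]
    (CA CB : VariableChange ℚ) (hCA : CA • A = cubeSumCurve (3 * (p : ℚ) ^ 2))
    (hCB : CB • B = cubeSumCurve (p : ℚ)) (hrank : (B.baseChange K).mordellWeilRank = 2)
    {NA NB : ℕ} [NeZero NA] [NeZero NB]
    (hNA : (cubeSumCurve (3 * (p : ℚ) ^ 2)).conductorNorm ℤ ∣ NA)
    (hNB : (cubeSumCurve (p : ℚ)).conductorNorm ℤ ∣ NB)
    (Y₀ : ((cubeSumCurve (p : ℚ)).baseChange K).toAffine.Point)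
    (hY₀ : ¬ ∃ Q : ((cubeSumCurve (p : ℚ)).baseChange K).toAffine.Point, (2 : ℕ) • Q = Y₀)
    (hL1 : ∃ (cA : ℕ → galH1Torsion ((cubeSumCurve (3 * (p : ℚ) ^ 2)).baseChange K) (2 : ℕ))
        (cB : ℕ → galH1Torsion ((cubeSumCurve (p : ℚ)).baseChange K) (2 : ℕ)),
      (∀ ℓ, (ℓ.Prime ∧ ¬ ℓ ∣ NA ∧ ¬ ℓ ∣ NB ∧ ¬ ((ℓ : ℤ) ∣ NumberField.discr K) ∧ ℓ ≠ 2 ∧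
          (Ideal.span {(ℓ : 𝓞 K)}).IsPrime ∧
          FrobEqFrobInfty (cubeSumCurve (3 * (p : ℚ) ^ 2)) K 2 ℓ ∧
          FrobEqFrobInfty (cubeSumCurve (p : ℚ)) K 2 ℓ) →
        (∀ v : HeightOneSpectrum (𝓞 K), (ℓ : 𝓞 K) ∉ v.asIdeal →
          cA ℓ ∈ selmerLocalKer ((cubeSumCurve (3 * (p : ℚ) ^ 2)).baseChange K)
            (v.adicCompletion K) (2 : ℕ)) ∧
        (∀ x : InfinitePlace K, cA ℓ ∈ selmerLocalKer
          ((cubeSumCurve (3 * (p : ℚ) ^ 2)).baseChange K) x.Completion (2 : ℕ)) ∧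
        (∀ v : HeightOneSpectrum (𝓞 K), (ℓ : 𝓞 K) ∈ v.asIdeal →
          (cA ℓ ∈ selmerLocalKer ((cubeSumCurve (3 * (p : ℚ) ^ 2)).baseChange K)
              (v.adicCompletion K) (2 : ℕ) ↔
            kummerClassOfPoint (cubeSumCurve (p : ℚ)) K Nat.prime_two Y₀ ∈
              ((cubeSumCurve (p : ℚ)).baseChange K).torsionLocalKer (v.adicCompletion K) (2 : ℕ)))) ∧
      (∀ ℓ ℓ', (ℓ.Prime ∧ ¬ ℓ ∣ NA ∧ ¬ ℓ ∣ NB ∧ ¬ ((ℓ : ℤ) ∣ NumberField.discr K) ∧ ℓ ≠ 2 ∧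
          (Ideal.span {(ℓ : 𝓞 K)}).IsPrime ∧
          FrobEqFrobInfty (cubeSumCurve (3 * (p : ℚ) ^ 2)) K 2 ℓ ∧
          FrobEqFrobInfty (cubeSumCurve (p : ℚ)) K 2 ℓ) →
        (ℓ'.Prime ∧ ¬ ℓ' ∣ NA ∧ ¬ ℓ' ∣ NB ∧ ¬ ((ℓ' : ℤ) ∣ NumberField.discr K) ∧ ℓ' ≠ 2 ∧
          (Ideal.span {(ℓ' : 𝓞 K)}).IsPrime ∧
          FrobEqFrobInfty (cubeSumCurve (3 * (p : ℚ) ^ 2)) K 2 ℓ' ∧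
          FrobEqFrobInfty (cubeSumCurve (p : ℚ)) K 2 ℓ') → ℓ ≠ ℓ' →
        (∀ v : HeightOneSpectrum (𝓞 K), (ℓ : 𝓞 K) ∉ v.asIdeal → (ℓ' : 𝓞 K) ∉ v.asIdeal →
          cB (ℓ * ℓ') ∈ selmerLocalKer ((cubeSumCurve (p : ℚ)).baseChange K)
            (v.adicCompletion K) (2 : ℕ)) ∧
        (∀ x : InfinitePlace K,
          cB (ℓ * ℓ') ∈ selmerLocalKer ((cubeSumCurve (p : ℚ)).baseChange K) x.Completion (2 : ℕ)) ∧
        (∀ v : HeightOneSpectrum (𝓞 K), (ℓ : 𝓞 K) ∈ v.asIdeal →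
          (cB (ℓ * ℓ') ∈ selmerLocalKer ((cubeSumCurve (p : ℚ)).baseChange K)
              (v.adicCompletion K) (2 : ℕ) ↔
            cA ℓ' ∈ ((cubeSumCurve (3 * (p : ℚ) ^ 2)).baseChange K).torsionLocalKer
              (v.adicCompletion K) (2 : ℕ))))) :
    Nat.card (AddCommGroup.primaryComponent B.sha 2) = 1 ∧
      Nat.card (AddCommGroup.primaryComponent A.sha 2) = 1 := by
  haveI : Fact (Nat.Prime 2) := ⟨Nat.prime_two⟩
  have hp2 : p ≠ 2 := by rintro rfl; norm_num at hp3
  have hp0 : (p : ℚ) ≠ 0 := by exact_mod_cast hp.ne_zero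
  have h3p0 : (3 * (p : ℚ) ^ 2) ≠ 0 := mul_ne_zero (by norm_num) (pow_ne_zero 2 hp0)
  haveI := Rank1Residual.X12.CubeSumFamilies.isElliptic_cubeSumCurve hp0
  haveI := Rank1Residual.X12.CubeSumFamilies.isElliptic_cubeSumCurve h3p0
  haveI hBK : ((cubeSumCurve (p : ℚ)).baseChange K).IsElliptic :=
    inferInstanceAs ((cubeSumCurve (p : ℚ)).map (algebraMap ℚ K)).IsElliptic
  haveI hAK : ((cubeSumCurve (3 * (p : ℚ) ^ 2)).baseChange K).IsElliptic :=
    inferInstanceAs ((cubeSumCurve (3 * (p : ℚ) ^ 2)).map (algebraMap ℚ K)).IsElliptic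
  -- ### rank on the short model; the conjugation `c`
  have hrank₀ : ((cubeSumCurve (p : ℚ)).baseChange K).mordellWeilRank = 2 :=
    mordellWeilRank_cubeSumCurve_of_variableChange B CB hCB hrank
  obtain ⟨-, -, c, hcω, -⟩ := JZero.exists_aut_apply_eq_sq K hω h2
  -- ### leaf (L3b), with its `[ζ]`-package `w = H¹(fnB)` over `g = H¹(φB)`
  obtain ⟨φB, fnB, hfnB, -, hφB, hcoeB, h3b⟩ :=
    exists_cmH1_infinite_kolyvaginPrimes_line_sylvesterPair_of_rank (NA := NA) (NB := NB)
      hω h2 hp hp3 hcω Y₀ hY₀ hrank₀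
  have hφBeq := smul_comm_of_apply_some_eq ((cubeSumCurve (p : ℚ)).baseChange K) ω φB hφB
  set w := resH1Hom (ContinuousMonoidHom.id _) fnB hfnB with hw_def
  set g := galH1Map φB hφBeq with hg_def
  have hw : ∀ x, torsionH1ToH1 ((cubeSumCurve (p : ℚ)).baseChange K) ((2 : ℕ) : ℤ) (w x) =
      g (torsionH1ToH1 ((cubeSumCurve (p : ℚ)).baseChange K) ((2 : ℕ) : ℤ) x) :=
    fun x ↦ torsionH1ToH1_resH1Hom_id _ fnB hfnB φB hφBeq hcoeB x
  -- ### the Kolyvagin-prime predicate of the (L3) files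
  set Kol : ℕ → Prop := fun ℓ ↦ ℓ.Prime ∧ ¬ ℓ ∣ NA ∧ ¬ ℓ ∣ NB ∧
      ¬ ((ℓ : ℤ) ∣ NumberField.discr K) ∧ ℓ ≠ 2 ∧ (Ideal.span {(ℓ : 𝓞 K)}).IsPrime ∧
      FrobEqFrobInfty (cubeSumCurve (3 * (p : ℚ) ^ 2)) K 2 ℓ ∧
      FrobEqFrobInfty (cubeSumCurve (p : ℚ)) K 2 ℓ with hKol_def
  have hKol : ∀ ℓ, Kol ℓ → ℓ.Prime ∧ (Ideal.span {(ℓ : 𝓞 K)}).IsPrime :=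
    fun ℓ h ↦ ⟨h.1, h.2.2.2.2.2.1⟩
  -- ### leaves (L2A), (L2B), (L3a)
  have hL2A := hL2_cubeSumCurve (K := K) h3p0 hω h2 hNA Kol
    (fun ℓ h ↦ ⟨h.1, h.2.1, h.2.2.2.1, h.2.2.2.2.1, h.2.2.2.2.2.1, h.2.2.2.2.2.2.1⟩)
  have hL2B := hL2_cubeSumCurve (K := K) hp0 hω h2 hNB Kol
    (fun ℓ h ↦ ⟨h.1, h.2.2.1, h.2.2.2.1, h.2.2.2.2.1, h.2.2.2.2.2.1, h.2.2.2.2.2.2.2⟩)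
  have hL3a := fun (s : galH1Torsion ((cubeSumCurve (3 * (p : ℚ) ^ 2)).baseChange K) ((2 : ℕ) : ℤ))
      (t : galH1Torsion ((cubeSumCurve (p : ℚ)).baseChange K) ((2 : ℕ) : ℤ)) ↦
    infinite_kolyvaginPrimes_ne_sylvesterPair (NA := NA) (NB := NB) hω h2 hp hp3 s t
  -- ### THEOREM K2 over `K`, then the Ш-currency over `ℚ`
  obtain ⟨hK2A, hK2B⟩ := selmerGroup_eq_bot_and_le_closure_of_coupledLeaves
    (cubeSumCurve (3 * (p : ℚ) ^ 2)) (cubeSumCurve (p : ℚ)) Nat.prime_two Kol hKol hY₀ w hL1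
    hL2A hL2B hL3a (fun s _ hs x hx ↦ h3b s hs x hx)
  have hCB' : CB • B = ⟨0, 0, 0, 0, -432 * (p : ℚ) ^ 2⟩ := hCB
  have hCA' : CA • A = ⟨0, 0, 0, 0, -432 * (3 * (p : ℚ) ^ 2) ^ 2⟩ := hCA
  haveI : ((⟨0, 0, 0, 0, -432 * (p : ℚ) ^ 2⟩ : WeierstrassCurve ℚ).baseChange K).IsElliptic := hBK
  haveI : ((⟨0, 0, 0, 0, -432 * (3 * (p : ℚ) ^ 2) ^ 2⟩ : WeierstrassCurve ℚ).baseChange K).IsElliptic :=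
    hAK
  exact natCard_primaryComponent_sha_eq_one_pair_of_selmer K hCA' hCB' hω h2 Nat.prime_two Y₀ w g hw
    hK2A hK2B

/-- **Some point of `E_p(K)` is not `2`-divisible** when `rank_ℤ E_p(K) = 2` (`K ∋ ω` quadratic,
`p ≠ 2` prime): the Kummer image `δ(E_p(K)) ⊆ H¹(K, E_p[2])` has four elements
(`natCard_range_kummerMapTorsion_cubeSumCurve`), while `δ(2Q) = 2·δ(Q) = 0`. -/
theorem exists_not_two_nsmul_eq_cubeSumCurve {ω : K} (hω : ω ^ 2 + ω + 1 = 0)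
    (h2 : Module.finrank ℚ K = 2) {p : ℕ} (hp : p.Prime) (hp2 : p ≠ 2)
    (hrank : ((cubeSumCurve (p : ℚ)).baseChange K).mordellWeilRank = 2) :
    ∃ Y₀ : ((cubeSumCurve (p : ℚ)).baseChange K).toAffine.Point,
      ¬ ∃ Q : ((cubeSumCurve (p : ℚ)).baseChange K).toAffine.Point, (2 : ℕ) • Q = Y₀ := by
  by_contra hall
  push Not at hall
  obtain ⟨hdiv, -⟩ : ∃ hdiv, kummerClassOfPoint (cubeSumCurve (p : ℚ)) K Nat.prime_two 0 =
      kummerMapTorsion ((cubeSumCurve (p : ℚ)).baseChange K) ((2 : ℕ) : ℤ) hdiv 0 := ⟨_, rfl⟩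
  set κ := kummerMapTorsion ((cubeSumCurve (p : ℚ)).baseChange K) ((2 : ℕ) : ℤ) hdiv with hκ
  have hM : Nat.card κ.range = 4 :=
    natCard_range_kummerMapTorsion_cubeSumCurve hω h2 hp hp2 hrank hdiv
  have hbot : κ.range = ⊥ := by
    rw [eq_bot_iff]
    rintro _ ⟨P, rfl⟩
    obtain ⟨Q, rfl⟩ := hall P
    rw [AddSubgroup.mem_bot, map_nsmul, ← natCast_zsmul]
    exact_mod_cast two_zsmul_galH1Torsion_two (cubeSumCurve (p : ℚ)) (κ Q)
  rw [hbot, AddSubgroup.card_bot] at hM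
  exact absurd hM (by norm_num)

end Pair

/-! ## §3 What VARIANT L's leaf stubs prove at EVERY member (no `Ш_an` hypothesis) -/

/-- **`stub_L1Four` (VARIANT L) proves THEOREM K2's CONCLUSION at EVERY member `p ≡ 4 (9)`** —
for every pair of minimal models `A ≅ E_{3p²}`, `B ≅ E_p`: `#Ш(B)[2^∞] = #Ш(A)[2^∞] = 1`, with NO
`ord₂(#Ш_an(B)·#Ш_an(A)) = 0` hypothesis.  `hL1` is the registered stub's statement VERBATIM; of
`PublishedFactsTwoPlus` only the conjunct `rank_ℤ B(ℚ(ζ₃)) = 2` of its display is used; the bottom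
point is ANY non-`2`-divisible point (`exists_not_two_nsmul_eq_cubeSumCurve`).  This conclusion is
false at the certified members with `Ш(E_p)[2] ≠ 0` — the stub over-claims (sibling file
`…CoupledDescentL1FamilyVacuity`). -/
theorem natCard_sha_eq_one_pair_of_L1Four
    (hL1 : ∀ (p : ℕ), p.Prime → p % 9 = 4 → (¬ ∃ x : ZMod p, x ^ 3 = 3) →
            ∀ (K : Type) [Field K] [NumberField K] (ω : K), ω ^ 2 + ω + 1 = 0 →
              Module.finrank ℚ K = 2 →
            ∀ Y₀ : ((cubeSumCurve (p : ℚ)).baseChange K).toAffine.Point,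
              (¬ ∃ Q : ((cubeSumCurve (p : ℚ)).baseChange K).toAffine.Point, (2 : ℕ) • Q = Y₀) →
            ∃ (cA : ℕ → galH1Torsion ((cubeSumCurve (3 * (p : ℚ) ^ 2)).baseChange K) (2 : ℕ))
              (cB : ℕ → galH1Torsion ((cubeSumCurve (p : ℚ)).baseChange K) (2 : ℕ)),
            (∀ ℓ, (ℓ.Prime ∧ ¬ ℓ ∣ (cubeSumCurve (3 * (p : ℚ) ^ 2)).conductorNorm ℤ ∧
                ¬ ℓ ∣ (cubeSumCurve (p : ℚ)).conductorNorm ℤ ∧ ¬ ((ℓ : ℤ) ∣ NumberField.discr K) ∧ ℓ ≠ 2 ∧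
                (Ideal.span {(ℓ : 𝓞 K)}).IsPrime ∧
                FrobEqFrobInfty (cubeSumCurve (3 * (p : ℚ) ^ 2)) K 2 ℓ ∧
                FrobEqFrobInfty (cubeSumCurve (p : ℚ)) K 2 ℓ) →
              (∀ v : HeightOneSpectrum (𝓞 K), (ℓ : 𝓞 K) ∉ v.asIdeal →
                cA ℓ ∈ selmerLocalKer ((cubeSumCurve (3 * (p : ℚ) ^ 2)).baseChange K)
                  (v.adicCompletion K) (2 : ℕ)) ∧
              (∀ x : InfinitePlace K, cA ℓ ∈ selmerLocalKer
                ((cubeSumCurve (3 * (p : ℚ) ^ 2)).baseChange K) x.Completion (2 : ℕ)) ∧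
              (∀ v : HeightOneSpectrum (𝓞 K), (ℓ : 𝓞 K) ∈ v.asIdeal →
                (cA ℓ ∈ selmerLocalKer ((cubeSumCurve (3 * (p : ℚ) ^ 2)).baseChange K)
                    (v.adicCompletion K) (2 : ℕ) ↔
                  kummerClassOfPoint (cubeSumCurve (p : ℚ)) K Nat.prime_two Y₀ ∈
                    ((cubeSumCurve (p : ℚ)).baseChange K).torsionLocalKer (v.adicCompletion K) (2 : ℕ)))) ∧
            (∀ ℓ ℓ', (ℓ.Prime ∧ ¬ ℓ ∣ (cubeSumCurve (3 * (p : ℚ) ^ 2)).conductorNorm ℤ ∧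
                ¬ ℓ ∣ (cubeSumCurve (p : ℚ)).conductorNorm ℤ ∧ ¬ ((ℓ : ℤ) ∣ NumberField.discr K) ∧ ℓ ≠ 2 ∧
                (Ideal.span {(ℓ : 𝓞 K)}).IsPrime ∧
                FrobEqFrobInfty (cubeSumCurve (3 * (p : ℚ) ^ 2)) K 2 ℓ ∧
                FrobEqFrobInfty (cubeSumCurve (p : ℚ)) K 2 ℓ) →
              (ℓ'.Prime ∧ ¬ ℓ' ∣ (cubeSumCurve (3 * (p : ℚ) ^ 2)).conductorNorm ℤ ∧
                ¬ ℓ' ∣ (cubeSumCurve (p : ℚ)).conductorNorm ℤ ∧ ¬ ((ℓ' : ℤ) ∣ NumberField.discr K) ∧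
                ℓ' ≠ 2 ∧ (Ideal.span {(ℓ' : 𝓞 K)}).IsPrime ∧
                FrobEqFrobInfty (cubeSumCurve (3 * (p : ℚ) ^ 2)) K 2 ℓ' ∧
                FrobEqFrobInfty (cubeSumCurve (p : ℚ)) K 2 ℓ') → ℓ ≠ ℓ' →
              (∀ v : HeightOneSpectrum (𝓞 K), (ℓ : 𝓞 K) ∉ v.asIdeal → (ℓ' : 𝓞 K) ∉ v.asIdeal →
                cB (ℓ * ℓ') ∈ selmerLocalKer ((cubeSumCurve (p : ℚ)).baseChange K)
                  (v.adicCompletion K) (2 : ℕ)) ∧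
              (∀ x : InfinitePlace K,
                cB (ℓ * ℓ') ∈ selmerLocalKer ((cubeSumCurve (p : ℚ)).baseChange K) x.Completion (2 : ℕ)) ∧
              (∀ v : HeightOneSpectrum (𝓞 K), (ℓ : 𝓞 K) ∈ v.asIdeal →
                (cB (ℓ * ℓ') ∈ selmerLocalKer ((cubeSumCurve (p : ℚ)).baseChange K)
                    (v.adicCompletion K) (2 : ℕ) ↔
                  cA ℓ' ∈ ((cubeSumCurve (3 * (p : ℚ) ^ 2)).baseChange K).torsionLocalKer
                    (v.adicCompletion K) (2 : ℕ))))) :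
    PublishedFactsTwoPlus →
    ∀ (p : ℕ), p.Prime → p % 9 = 4 → (¬ ∃ x : ZMod p, x ^ 3 = 3) →
      ∀ (A B : WeierstrassCurve ℚ) [A.IsElliptic] [A.IsGloballyMinimal] [B.IsElliptic]
        [B.IsGloballyMinimal], (∃ C : VariableChange ℚ, C • B = HuShuYin2019.cubeSumCurve (p : ℚ)) →
        (∃ C : VariableChange ℚ, C • A = HuShuYin2019.cubeSumCurve (3 * (p : ℚ) ^ 2)) →
          Nat.card (AddCommGroup.primaryComponent B.sha 2) = 1 ∧
            Nat.card (AddCommGroup.primaryComponent A.sha 2) = 1 := by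
  intro hF p hp h9 h3 A B _ _ _ _ hB hA
  -- the CM field `K = ℚ(ζ₃)` with `ω = ζ₃`
  haveI : IsCyclotomicExtension {3} ℚ (CyclotomicField 3 ℚ) :=
    CyclotomicField.isCyclotomicExtension 3 ℚ
  obtain ⟨ω, hω⟩ : ∃ ω : CyclotomicField 3 ℚ, ω ^ 2 + ω + 1 = 0 :=
    ⟨_, SylvesterTwoCMNormForm.sq_add_self_add_one_eq_zero_of_isPrimitiveRoot
      (IsCyclotomicExtension.zeta_spec 3 ℚ (CyclotomicField 3 ℚ))⟩
  have h2 : Module.finrank ℚ (CyclotomicField 3 ℚ) = 2 :=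
    SylvesterTwoCMNormForm.finrank_cyclotomicField_three
  -- `rank_ℤ B(K) = 2` from the route's display (its only use here)
  obtain ⟨-, -, -, -, -, hrank, -⟩ := hF.2 p hp (Or.inl h9) h3 A B hB hA (CyclotomicField 3 ℚ) ω hω h2
  obtain ⟨CB, hCB⟩ := hB
  obtain ⟨CA, hCA⟩ := hA
  have hp3 : p % 3 = 1 := by omega
  have hp2 : p ≠ 2 := by rintro rfl; norm_num at h9
  have hp0 : (p : ℚ) ≠ 0 := by exact_mod_cast hp.ne_zero
  have h3p0 : (3 * (p : ℚ) ^ 2) ≠ 0 := mul_ne_zero (by norm_num) (pow_ne_zero 2 hp0)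
  haveI := Rank1Residual.X12.CubeSumFamilies.isElliptic_cubeSumCurve hp0
  haveI := Rank1Residual.X12.CubeSumFamilies.isElliptic_cubeSumCurve h3p0
  -- levels = conductors
  haveI : NeZero ((cubeSumCurve (p : ℚ)).conductorNorm ℤ) :=
    ⟨(conductorNorm_pos_holds (cubeSumCurve (p : ℚ))).ne'⟩
  haveI : NeZero ((cubeSumCurve (3 * (p : ℚ) ^ 2)).conductorNorm ℤ) :=
    ⟨(conductorNorm_pos_holds (cubeSumCurve (3 * (p : ℚ) ^ 2))).ne'⟩
  -- ANY non-`2`-divisible bottom point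
  have hrank₀ : ((cubeSumCurve (p : ℚ)).baseChange (CyclotomicField 3 ℚ)).mordellWeilRank = 2 :=
    mordellWeilRank_cubeSumCurve_of_variableChange B CB hCB hrank
  obtain ⟨Y₀, hY₀⟩ := exists_not_two_nsmul_eq_cubeSumCurve hω h2 hp hp2 hrank₀
  exact natCard_primaryComponent_sha_eq_one_pair_of_nondiv_of_L1 h2 hω hp hp3 A B CA CB hCA hCB
    hrank dvd_rfl dvd_rfl Y₀ hY₀ (hL1 p hp h9 h3 (CyclotomicField 3 ℚ) ω hω h2 Y₀ hY₀)

/-- **`stub_L1Seven` (VARIANT L) proves THEOREM K2's CONCLUSION at EVERY member `p ≡ 7 (9)`** —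
for every pair of minimal models `A ≅ E_{3p²}`, `B ≅ E_p`: `#Ш(B)[2^∞] = #Ш(A)[2^∞] = 1`, with NO
`ord₂(#Ш_an(B)·#Ш_an(A)) = 0` hypothesis.  `hL1` is the registered stub's statement VERBATIM; of
`PublishedFactsTwoPlus` only the conjunct `rank_ℤ B(ℚ(ζ₃)) = 2` of its display is used; the bottom
point is ANY non-`2`-divisible point (`exists_not_two_nsmul_eq_cubeSumCurve`).  This conclusion is
false at the certified members with `Ш(E_p)[2] ≠ 0` — the stub over-claims (sibling file
`…CoupledDescentL1FamilyVacuity`). -/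
theorem natCard_sha_eq_one_pair_of_L1Seven
    (hL1 : ∀ (p : ℕ), p.Prime → p % 9 = 7 → (¬ ∃ x : ZMod p, x ^ 3 = 3) →
            ∀ (K : Type) [Field K] [NumberField K] (ω : K), ω ^ 2 + ω + 1 = 0 →
              Module.finrank ℚ K = 2 →
            ∀ Y₀ : ((cubeSumCurve (p : ℚ)).baseChange K).toAffine.Point,
              (¬ ∃ Q : ((cubeSumCurve (p : ℚ)).baseChange K).toAffine.Point, (2 : ℕ) • Q = Y₀) →
            ∃ (cA : ℕ → galH1Torsion ((cubeSumCurve (3 * (p : ℚ) ^ 2)).baseChange K) (2 : ℕ))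
              (cB : ℕ → galH1Torsion ((cubeSumCurve (p : ℚ)).baseChange K) (2 : ℕ)),
            (∀ ℓ, (ℓ.Prime ∧ ¬ ℓ ∣ (cubeSumCurve (3 * (p : ℚ) ^ 2)).conductorNorm ℤ ∧
                ¬ ℓ ∣ (cubeSumCurve (p : ℚ)).conductorNorm ℤ ∧ ¬ ((ℓ : ℤ) ∣ NumberField.discr K) ∧ ℓ ≠ 2 ∧
                (Ideal.span {(ℓ : 𝓞 K)}).IsPrime ∧
                FrobEqFrobInfty (cubeSumCurve (3 * (p : ℚ) ^ 2)) K 2 ℓ ∧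
                FrobEqFrobInfty (cubeSumCurve (p : ℚ)) K 2 ℓ) →
              (∀ v : HeightOneSpectrum (𝓞 K), (ℓ : 𝓞 K) ∉ v.asIdeal →
                cA ℓ ∈ selmerLocalKer ((cubeSumCurve (3 * (p : ℚ) ^ 2)).baseChange K)
                  (v.adicCompletion K) (2 : ℕ)) ∧
              (∀ x : InfinitePlace K, cA ℓ ∈ selmerLocalKer
                ((cubeSumCurve (3 * (p : ℚ) ^ 2)).baseChange K) x.Completion (2 : ℕ)) ∧
              (∀ v : HeightOneSpectrum (𝓞 K), (ℓ : 𝓞 K) ∈ v.asIdeal →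
                (cA ℓ ∈ selmerLocalKer ((cubeSumCurve (3 * (p : ℚ) ^ 2)).baseChange K)
                    (v.adicCompletion K) (2 : ℕ) ↔
                  kummerClassOfPoint (cubeSumCurve (p : ℚ)) K Nat.prime_two Y₀ ∈
                    ((cubeSumCurve (p : ℚ)).baseChange K).torsionLocalKer (v.adicCompletion K) (2 : ℕ)))) ∧
            (∀ ℓ ℓ', (ℓ.Prime ∧ ¬ ℓ ∣ (cubeSumCurve (3 * (p : ℚ) ^ 2)).conductorNorm ℤ ∧
                ¬ ℓ ∣ (cubeSumCurve (p : ℚ)).conductorNorm ℤ ∧ ¬ ((ℓ : ℤ) ∣ NumberField.discr K) ∧ ℓ ≠ 2 ∧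
                (Ideal.span {(ℓ : 𝓞 K)}).IsPrime ∧
                FrobEqFrobInfty (cubeSumCurve (3 * (p : ℚ) ^ 2)) K 2 ℓ ∧
                FrobEqFrobInfty (cubeSumCurve (p : ℚ)) K 2 ℓ) →
              (ℓ'.Prime ∧ ¬ ℓ' ∣ (cubeSumCurve (3 * (p : ℚ) ^ 2)).conductorNorm ℤ ∧
                ¬ ℓ' ∣ (cubeSumCurve (p : ℚ)).conductorNorm ℤ ∧ ¬ ((ℓ' : ℤ) ∣ NumberField.discr K) ∧
                ℓ' ≠ 2 ∧ (Ideal.span {(ℓ' : 𝓞 K)}).IsPrime ∧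
                FrobEqFrobInfty (cubeSumCurve (3 * (p : ℚ) ^ 2)) K 2 ℓ' ∧
                FrobEqFrobInfty (cubeSumCurve (p : ℚ)) K 2 ℓ') → ℓ ≠ ℓ' →
              (∀ v : HeightOneSpectrum (𝓞 K), (ℓ : 𝓞 K) ∉ v.asIdeal → (ℓ' : 𝓞 K) ∉ v.asIdeal →
                cB (ℓ * ℓ') ∈ selmerLocalKer ((cubeSumCurve (p : ℚ)).baseChange K)
                  (v.adicCompletion K) (2 : ℕ)) ∧
              (∀ x : InfinitePlace K,
                cB (ℓ * ℓ') ∈ selmerLocalKer ((cubeSumCurve (p : ℚ)).baseChange K) x.Completion (2 : ℕ)) ∧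
              (∀ v : HeightOneSpectrum (𝓞 K), (ℓ : 𝓞 K) ∈ v.asIdeal →
                (cB (ℓ * ℓ') ∈ selmerLocalKer ((cubeSumCurve (p : ℚ)).baseChange K)
                    (v.adicCompletion K) (2 : ℕ) ↔
                  cA ℓ' ∈ ((cubeSumCurve (3 * (p : ℚ) ^ 2)).baseChange K).torsionLocalKer
                    (v.adicCompletion K) (2 : ℕ))))) :
    PublishedFactsTwoPlus →
    ∀ (p : ℕ), p.Prime → p % 9 = 7 → (¬ ∃ x : ZMod p, x ^ 3 = 3) →
      ∀ (A B : WeierstrassCurve ℚ) [A.IsElliptic] [A.IsGloballyMinimal] [B.IsElliptic]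
        [B.IsGloballyMinimal], (∃ C : VariableChange ℚ, C • B = HuShuYin2019.cubeSumCurve (p : ℚ)) →
        (∃ C : VariableChange ℚ, C • A = HuShuYin2019.cubeSumCurve (3 * (p : ℚ) ^ 2)) →
          Nat.card (AddCommGroup.primaryComponent B.sha 2) = 1 ∧
            Nat.card (AddCommGroup.primaryComponent A.sha 2) = 1 := by
  intro hF p hp h9 h3 A B _ _ _ _ hB hA
  -- the CM field `K = ℚ(ζ₃)` with `ω = ζ₃`
  haveI : IsCyclotomicExtension {3} ℚ (CyclotomicField 3 ℚ) :=
    CyclotomicField.isCyclotomicExtension 3 ℚ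
  obtain ⟨ω, hω⟩ : ∃ ω : CyclotomicField 3 ℚ, ω ^ 2 + ω + 1 = 0 :=
    ⟨_, SylvesterTwoCMNormForm.sq_add_self_add_one_eq_zero_of_isPrimitiveRoot
      (IsCyclotomicExtension.zeta_spec 3 ℚ (CyclotomicField 3 ℚ))⟩
  have h2 : Module.finrank ℚ (CyclotomicField 3 ℚ) = 2 :=
    SylvesterTwoCMNormForm.finrank_cyclotomicField_three
  -- `rank_ℤ B(K) = 2` from the route's display (its only use here)
  obtain ⟨-, -, -, -, -, hrank, -⟩ := hF.2 p hp (Or.inr h9) h3 A B hB hA (CyclotomicField 3 ℚ) ω hω h2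
  obtain ⟨CB, hCB⟩ := hB
  obtain ⟨CA, hCA⟩ := hA
  have hp3 : p % 3 = 1 := by omega
  have hp2 : p ≠ 2 := by rintro rfl; norm_num at h9
  have hp0 : (p : ℚ) ≠ 0 := by exact_mod_cast hp.ne_zero
  have h3p0 : (3 * (p : ℚ) ^ 2) ≠ 0 := mul_ne_zero (by norm_num) (pow_ne_zero 2 hp0)
  haveI := Rank1Residual.X12.CubeSumFamilies.isElliptic_cubeSumCurve hp0
  haveI := Rank1Residual.X12.CubeSumFamilies.isElliptic_cubeSumCurve h3p0
  -- levels = conductors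
  haveI : NeZero ((cubeSumCurve (p : ℚ)).conductorNorm ℤ) :=
    ⟨(conductorNorm_pos_holds (cubeSumCurve (p : ℚ))).ne'⟩
  haveI : NeZero ((cubeSumCurve (3 * (p : ℚ) ^ 2)).conductorNorm ℤ) :=
    ⟨(conductorNorm_pos_holds (cubeSumCurve (3 * (p : ℚ) ^ 2))).ne'⟩
  -- ANY non-`2`-divisible bottom point
  have hrank₀ : ((cubeSumCurve (p : ℚ)).baseChange (CyclotomicField 3 ℚ)).mordellWeilRank = 2 :=
    mordellWeilRank_cubeSumCurve_of_variableChange B CB hCB hrank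
  obtain ⟨Y₀, hY₀⟩ := exists_not_two_nsmul_eq_cubeSumCurve hω h2 hp hp2 hrank₀
  exact natCard_primaryComponent_sha_eq_one_pair_of_nondiv_of_L1 h2 hω hp hp3 A B CA CB hCA hCB
    hrank dvd_rfl dvd_rfl Y₀ hY₀ (hL1 p hp h9 h3 (CyclotomicField 3 ℚ) ω hω h2 Y₀ hY₀)

end Summit.BirchSwinnertonDyer.BirchSwinnertonDyer.Theorems.SylvesterTwoCoupledDescentCebotarev

end
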